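import Summits.Langlands.Langlands.Theses.EisensteinGelfandKirillov

/-!
# Route EisensteinGelfandKirillov — Assembly

The assembly item (stmt-Langlands-18276) of route `EisensteinGelfandKirillov` for the Langlands summit:
`EisensteinGKBound → ProModularOfGKBound → CrystallineProModularClassical → SectorComplement → Langlands`.

This is literally the type of the route file's sorry-free deciding theorem
`Summit.Langlands.Langlands.Theses.EisensteinGelfandKirillov.closes`: the door (`EisensteinGKBound`,
the Gelfand–Kirillov bound at an Eisenstein maximal ideal) feeds the engine (`ProModularOfGKBound`,
pro-modularity of the residually upper-triangular `p`-distinguished sector), the exit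
(`CrystallineProModularClassical`) makes the crystalline Hodge–Tate-regular pro-modular `ρ` classical —
together the sector theorem `ReducibleCrystallineModular` — and
`SectorComplement := ReducibleCrystallineModular → Langlands` finishes. No mathematical content lives
here; the content of the route is in items 2–4.
-/

set_option linter.dupNamespace false -- project-wide option (lakefile weak.linter.dupNamespace); `Summit.Langlands.Langlands` is the mandated namespace

namespace Summit.Langlands.Langlands.Theorems

/-- **Assembly of route EisensteinGelfandKirillov** (settles stmt-Langlands-18276).
`EisensteinGKBound → ProModularOfGKBound → CrystallineProModularClassical → SectorComplement → Langlands`: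
the Eisenstein Gelfand–Kirillov bound, the pro-modularity engine it feeds, classicality of crystalline
Hodge–Tate-regular pro-modular `ρ`, and the complement of that sector imply the summit statement
`Langlands` of `Summits/Langlands/Statement.lean`. Proof: unfold `Assembly` and apply the route's
sorry-free deciding theorem `Theses.EisensteinGelfandKirillov.closes` (modus ponens through the target
`ReducibleCrystallineModular`). [folklore] -/
theorem eisensteinGelfandKirillov_assembly_proof :
    Summit.Langlands.Langlands.Theses.EisensteinGelfandKirillov.Assembly := by
  unfold Summit.Langlands.Langlands.Theses.EisensteinGelfandKirillov.Assembly
  exact Summit.Langlands.Langlands.Theses.EisensteinGelfandKirillov.closes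

end Summit.Langlands.Langlands.Theorems
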